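import Summits.AtomisticToContinuum.FouriersLaw.Theorems.JunctionLocalityNonBallisticLightConePropagation

/-!
# Leaf (C) `stub_anchoredCorrelationTails` (light cone of the OPEN chain at fixed time, uniformly in `N`), part 1:
local Lipschitz bounds for the cubic forces
(crux `EmbeddedDrudeMourre.AbelThermodynamicLimit`, item stmt-AtomisticToContinuum-12596, line
`loomis-compact-horizon-witness`; `--supports` file proving the registered sub-goal `stub_coneLocalDriftLipschitz`)

The leaf is proved (parts 1–7, `…AnchoredCorrelationTails*`) by the synchronous coupling of crux
`JunctionLocality.NonBallistic` (two strong solutions of the Langevin chain driven by the SAME noise, from `x` and from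
`x` with one momentum flipped), made `N`-uniform at a FIXED distance by DISTANCE-GROWING BOXES
`q_j(s)² ≤ R² max(1, |j - i₀|/D)` in place of a box common to all `N` sites. This part: the LOCAL form of the box
Lipschitz bound of the cubic nearest-neighbour forces (`pinnedChain_abs_dPotential_sub_le_local`,
`pinnedChain_abs_drift_snd_sub_le_local`: only the positions at `i-1, i, i+1` enter the force at `i`; the tree's
`LightConePropagation.pinnedChain_abs_drift_snd_sub_le` asks for the box at every site), and the Buttà–Marchioro weight
`g(n) = max(1, n/D)` of the growing boxes (`coneWeight_props`: `g ≥ 1`, monotone, `g(n) ≤ 3 + n`, `g(2m)/m` antitone —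
the hypotheses of `BMLightCone.lattice_iteration_far`).
-/

noncomputable section

namespace Summit.AtomisticToContinuum.FouriersLaw.Theorems.AbelThermodynamicLimit.LoomisCompactHorizonWitness

open MeasureTheory Set Filter Topology
open Literature.MathematicalPhysics.KineticTheory.HeatConduction
open Summit.AtomisticToContinuum.FouriersLaw.Theorems.NonBallistic
open Summit.AtomisticToContinuum.FouriersLaw.Theorems.NonBallistic.LightConePropagation

variable {N : ℕ} {ω₂ lam β γ : ℝ}

/-! ### §1 Propagation with distance-growing boxes: local Lipschitz bounds for the cubic forces -/

/-- **Local Lipschitz bound for the force of the pinned chain.** If the positions of `q` and `q'` at the sites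
`i-1, i, i+1` (those present in the chain) lie in `[-ρ, ρ]` and differ by at most `d_j` there (`d ≥ 0` on `ℤ`),
then `|∂_iΦ(q') - ∂_iΦ(q)| ≤ (ω₂ + 3 lam ρ² + 2(1 + 12 β ρ²)) d_i + (1 + 12 β ρ²)(d_{i-1} + d_{i+1})`. [folklore] -/
theorem pinnedChain_abs_dPotential_sub_le_local (hω : 0 ≤ ω₂) (hl : 0 ≤ lam) (hβ : 0 ≤ β) (γ : ℝ) {ρ : ℝ}
    {q q' : Fin N → ℝ} (i : Fin N)
    (hq : ∀ j : Fin N, ((j : ℤ) - (i : ℤ)).natAbs ≤ 1 → |q j| ≤ ρ)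
    (hq' : ∀ j : Fin N, ((j : ℤ) - (i : ℤ)).natAbs ≤ 1 → |q' j| ≤ ρ)
    {d : ℤ → ℝ} (hd0 : ∀ k, 0 ≤ d k)
    (hd : ∀ j : Fin N, ((j : ℤ) - (i : ℤ)).natAbs ≤ 1 → |q' j - q j| ≤ d j) :
    |(pinnedChain ω₂ lam β γ).dPotential N i q' - (pinnedChain ω₂ lam β γ).dPotential N i q| ≤
      (ω₂ + 3 * lam * ρ ^ 2 + 2 * (1 + 12 * β * ρ ^ 2)) * d i +
        (1 + 12 * β * ρ ^ 2) * (d (i - 1) + d (i + 1)) := by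
  -- adapted from `LightConePropagation.pinnedChain_abs_dPotential_sub_le` (…NonBallisticLightConePropagationAux1)
  rw [OscillatorChain.dPotential_eq_closed, OscillatorChain.dPotential_eq_closed]
  simp only [pinnedChain_deriv_U, pinnedChain_deriv_V]
  set KV := 1 + 12 * β * ρ ^ 2 with hKV_def
  have hi0 : ((i : ℤ) - (i : ℤ)).natAbs ≤ 1 := by simp
  have hR : 0 ≤ ρ := (abs_nonneg _).trans (hq i hi0)
  have hKV : 0 ≤ KV := by positivity
  -- pinning term
  have hU : |(ω₂ * q' i + lam * q' i ^ 3) - (ω₂ * q i + lam * q i ^ 3)| ≤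
      (ω₂ + 3 * lam * ρ ^ 2) * d i :=
    (abs_cubic_sub_cubic_le hω hl (hq' i hi0) (hq i hi0)).trans
      (mul_le_mul_of_nonneg_left (hd i hi0) (by positivity))
  -- a bond term between two sites near `i`
  have hV : ∀ j l : Fin N, ((j : ℤ) - (i : ℤ)).natAbs ≤ 1 → ((l : ℤ) - (i : ℤ)).natAbs ≤ 1 →
      |(q' l - q' j + β * (q' l - q' j) ^ 3) - (q l - q j + β * (q l - q j) ^ 3)| ≤ KV * (d l + d j) := by
    intro j l hj hl'
    have h2R : |q l - q j| ≤ 2 * ρ := (abs_sub _ _).trans (by linarith [hq l hl', hq j hj])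
    have h2R' : |q' l - q' j| ≤ 2 * ρ := (abs_sub _ _).trans (by linarith [hq' l hl', hq' j hj])
    have h := abs_cubic_sub_cubic_le (c₁ := 1) zero_le_one hβ h2R' h2R
    rw [one_mul, one_mul] at h
    refine h.trans ?_
    have e : (1 + 3 * β * (2 * ρ) ^ 2) = KV := by rw [hKV_def]; ring
    rw [e]
    refine mul_le_mul_of_nonneg_left ?_ hKV
    calc |q' l - q' j - (q l - q j)| = |(q' l - q l) - (q' j - q j)| := by ring_nf
      _ ≤ |q' l - q l| + |q' j - q j| := abs_sub _ _
      _ ≤ d l + d j := add_le_add (hd l hl') (hd j hj)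
  -- left bond
  have hL : |(if h : 0 < i.val then q' i - q' ⟨i.val - 1, by omega⟩ + β * (q' i - q' ⟨i.val - 1, by omega⟩) ^ 3
        else 0) -
      (if h : 0 < i.val then q i - q ⟨i.val - 1, by omega⟩ + β * (q i - q ⟨i.val - 1, by omega⟩) ^ 3
        else 0)| ≤ KV * (d i + d (i - 1)) := by
    by_cases h : 0 < i.val
    · rw [dif_pos h, dif_pos h]
      have e : (((⟨i.val - 1, by omega⟩ : Fin N) : ℕ) : ℤ) = (i : ℤ) - 1 := by
        show ((i.val - 1 : ℕ) : ℤ) = (i : ℤ) - 1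
        omega
      have hj1 : ((((⟨i.val - 1, by omega⟩ : Fin N) : ℕ) : ℤ) - (i : ℤ)).natAbs ≤ 1 := by
        rw [e]; simp
      have h1 := hV ⟨i.val - 1, by omega⟩ i hj1 hi0
      rwa [e] at h1
    · rw [dif_neg h, dif_neg h, sub_zero, abs_zero]
      exact mul_nonneg hKV (add_nonneg (hd0 _) (hd0 _))
  -- right bond
  have hRb : |(if h : i.val + 1 < N then q' ⟨i.val + 1, h⟩ - q' i + β * (q' ⟨i.val + 1, h⟩ - q' i) ^ 3
        else 0) -
      (if h : i.val + 1 < N then q ⟨i.val + 1, h⟩ - q i + β * (q ⟨i.val + 1, h⟩ - q i) ^ 3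
        else 0)| ≤ KV * (d (i + 1) + d i) := by
    by_cases h : i.val + 1 < N
    · rw [dif_pos h, dif_pos h]
      have e : (((⟨i.val + 1, h⟩ : Fin N) : ℕ) : ℤ) = (i : ℤ) + 1 := by
        show ((i.val + 1 : ℕ) : ℤ) = (i : ℤ) + 1
        omega
      have hj1 : ((((⟨i.val + 1, h⟩ : Fin N) : ℕ) : ℤ) - (i : ℤ)).natAbs ≤ 1 := by
        rw [e]; simp
      have h1 := hV i ⟨i.val + 1, h⟩ hi0 hj1
      rwa [e] at h1
    · rw [dif_neg h, dif_neg h, sub_zero, abs_zero]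
      exact mul_nonneg hKV (add_nonneg (hd0 _) (hd0 _))
  -- combine
  have key : ∀ (u u' v v' w w' : ℝ), (u' + v' - w') - (u + v - w) = (u' - u) + (v' - v) - (w' - w) := by
    intros; ring
  rw [key]
  refine (abs_sub _ _).trans ((add_le_add ((abs_add_le _ _).trans (add_le_add hU hL)) hRb).trans ?_)
  nlinarith [hd0 i, hd0 (i - 1), hd0 (i + 1)]

/-- **Local Lipschitz bound for the momentum drift** (`Y(z)_{p,i} = -∂_iΦ(q) - γ w_i p_i`, `0 ≤ w_i ≤ 2`): with the
positions at `i-1, i, i+1` of both states in `[-ρ, ρ]`, position deviations `≤ d_j` there and `|δp_i| ≤ d_i`,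
`|Y(z')_{p,i} - Y(z)_{p,i}| ≤ (ω₂ + 3 lam ρ² + 2(1 + 12βρ²) + 2γ) d_i + (1 + 12βρ²)(d_{i-1} + d_{i+1})`. [folklore] -/
theorem pinnedChain_abs_drift_snd_sub_le_local (hω : 0 ≤ ω₂) (hl : 0 ≤ lam) (hβ : 0 ≤ β) (hγ : 0 ≤ γ) {ρ : ℝ}
    {z z' : PhaseSpace N} (i : Fin N)
    (hq : ∀ j : Fin N, ((j : ℤ) - (i : ℤ)).natAbs ≤ 1 → |z.1 j| ≤ ρ)
    (hq' : ∀ j : Fin N, ((j : ℤ) - (i : ℤ)).natAbs ≤ 1 → |z'.1 j| ≤ ρ)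
    {d : ℤ → ℝ} (hd0 : ∀ k, 0 ≤ d k)
    (hd1 : ∀ j : Fin N, ((j : ℤ) - (i : ℤ)).natAbs ≤ 1 → |z'.1 j - z.1 j| ≤ d j)
    (hd2 : |z'.2 i - z.2 i| ≤ d i) :
    |((pinnedChain ω₂ lam β γ).drift N z').2 i - ((pinnedChain ω₂ lam β γ).drift N z).2 i| ≤
      (ω₂ + 3 * lam * ρ ^ 2 + 2 * (1 + 12 * β * ρ ^ 2) + 2 * γ) * d i +
        (1 + 12 * β * ρ ^ 2) * (d (i - 1) + d (i + 1)) := by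
  -- adapted from `LightConePropagation.pinnedChain_abs_drift_snd_sub_le`
  rw [pinnedChain_drift_apply, pinnedChain_drift_apply]
  dsimp only
  have hF := pinnedChain_abs_dPotential_sub_le_local hω hl hβ γ i hq hq' hd0 hd1
  have hw0 := bathWeight_nonneg N i
  have hw2 := bathWeight_le_two N i
  have hfr : |γ * OscillatorChain.bathWeight N i * z'.2 i - γ * OscillatorChain.bathWeight N i * z.2 i| ≤
      2 * γ * d i := by
    rw [← mul_sub, abs_mul, abs_of_nonneg (mul_nonneg hγ hw0)]
    calc γ * OscillatorChain.bathWeight N i * |z'.2 i - z.2 i| ≤ γ * 2 * d i :=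
          mul_le_mul (mul_le_mul_of_nonneg_left hw2 hγ) hd2 (abs_nonneg _) (by positivity)
      _ = 2 * γ * d i := by ring
  have key : ∀ F F' f f' : ℝ, (-F' - f') - (-F - f) = -((F' - F) + (f' - f)) := by intros; ring
  rw [key, abs_neg]
  refine (abs_add_le _ _).trans ((add_le_add hF hfr).trans (le_of_eq ?_))
  ring

/-! ### §1.2 The weight `g(n) = max(1, n/D)` -/

/-- The BM weight of the distance-growing boxes. [folklore] -/
theorem coneWeight_props {D : ℕ} (hD : 1 ≤ D) :
    (∀ n : ℕ, (1 : ℝ) ≤ max 1 ((n : ℝ) / D)) ∧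
    (Monotone fun n : ℕ => max (1 : ℝ) ((n : ℝ) / D)) ∧
    (∀ n : ℕ, max (1 : ℝ) ((n : ℝ) / D) ≤ 3 + n) ∧
    (∀ m m' : ℕ, 1 ≤ m → m ≤ m' →
      (m : ℝ) * max (1 : ℝ) (((2 * m' : ℕ) : ℝ) / D) ≤ m' * max (1 : ℝ) (((2 * m : ℕ) : ℝ) / D)) := by
  have hD0 : (0 : ℝ) < D := by exact_mod_cast hD
  have hD1 : (1 : ℝ) ≤ D := by exact_mod_cast hD
  refine ⟨fun n => le_max_left _ _, ?_, ?_, ?_⟩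
  · intro a b hab
    exact max_le_max le_rfl (div_le_div_of_nonneg_right (by exact_mod_cast hab) hD0.le)
  · intro n
    have hn : (0 : ℝ) ≤ n := n.cast_nonneg
    refine max_le (by linarith) ?_
    rw [div_le_iff₀ hD0]
    nlinarith
  · intro m m' hm hmm'
    have hm0 : (0 : ℝ) < m := by exact_mod_cast hm
    have hmm'r : (m : ℝ) ≤ m' := by exact_mod_cast hmm'
    push_cast
    by_cases hc : (1 : ℝ) ≤ 2 * (m : ℝ) / D
    · have hc' : (1 : ℝ) ≤ 2 * (m' : ℝ) / D := by
        refine hc.trans ?_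
        exact div_le_div_of_nonneg_right (by linarith) hD0.le
      rw [max_eq_right hc, max_eq_right hc']
      apply le_of_eq
      rw [div_eq_mul_inv, div_eq_mul_inv]
      ring
    · push Not at hc
      rw [max_eq_left hc.le, mul_one, mul_max_of_nonneg _ _ hm0.le, mul_one]
      refine max_le hmm'r ?_
      have e : (m : ℝ) * (2 * (m' : ℝ) / D) = (m' : ℝ) * (2 * (m : ℝ) / D) := by
        rw [div_eq_mul_inv, div_eq_mul_inv]
        ring
      rw [e]
      have hm'0 : (0 : ℝ) ≤ m' := (m' : ℕ).cast_nonneg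
      nlinarith


/-- **Registered sub-goal `stub_coneLocalDriftLipschitz`** (leaf (C) of S4, line `loomis-compact-horizon-witness`):
the LOCAL box Lipschitz bound of the momentum drift of the pinned chain — only the positions at `i-1, i, i+1` enter the
force at `i` (`pinnedChain_abs_drift_snd_sub_le_local`, closed form). [folklore] -/
theorem stub_coneLocalDriftLipschitz :
    ∀ ω₂ lam β γ : ℝ, 0 ≤ ω₂ → 0 ≤ lam → 0 ≤ β → 0 ≤ γ → ∀ (N : ℕ) (ρ : ℝ)
      (z z' : Literature.MathematicalPhysics.KineticTheory.HeatConduction.PhaseSpace N) (i : Fin N) (d : ℤ → ℝ),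
      (∀ j : Fin N, ((j : ℤ) - (i : ℤ)).natAbs ≤ 1 → |z.1 j| ≤ ρ) →
      (∀ j : Fin N, ((j : ℤ) - (i : ℤ)).natAbs ≤ 1 → |z'.1 j| ≤ ρ) →
      (∀ k, 0 ≤ d k) →
      (∀ j : Fin N, ((j : ℤ) - (i : ℤ)).natAbs ≤ 1 → |z'.1 j - z.1 j| ≤ d j) →
      |z'.2 i - z.2 i| ≤ d i →
      |((Literature.MathematicalPhysics.KineticTheory.HeatConduction.pinnedChain ω₂ lam β γ).drift N z').2 i -
          ((Literature.MathematicalPhysics.KineticTheory.HeatConduction.pinnedChain ω₂ lam β γ).drift N z).2 i| ≤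
        (ω₂ + 3 * lam * ρ ^ 2 + 2 * (1 + 12 * β * ρ ^ 2) + 2 * γ) * d i +
          (1 + 12 * β * ρ ^ 2) * (d (i - 1) + d (i + 1)) :=
  fun _ _ _ _ hω hl hβ hγ _ _ _ _ i _ hq hq' hd0 hd1 hd2 =>
    pinnedChain_abs_drift_snd_sub_le_local hω hl hβ hγ i hq hq' hd0 hd1 hd2

end Summit.AtomisticToContinuum.FouriersLaw.Theorems.AbelThermodynamicLimit.LoomisCompactHorizonWitness

end
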